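import Literature.AlgebraicGeometry.Frobenioids.Prop55SubRatStdSlot
import Literature.AlgebraicGeometry.Frobenioids.Prop55SubRatStdClosers
import Literature.AlgebraicGeometry.Frobenioids.Prop55SubStandardClosers
import Literature.AlgebraicGeometry.Frobenioids.Prop55iiiRlfModel
import Literature.AlgebraicGeometry.Frobenioids.ModelFrobenioidPhiBirat
import Literature.AlgebraicGeometry.Frobenioids.ModelFrobenioidPullbacks
import Literature.AlgebraicGeometry.Frobenioids.PerfFactorialSupport
import Literature.AlgebraicGeometry.Frobenioids.RlfPrimes
import HarnessLib

/-!
# Frobenioids I, Proposition 5.5 (iii), "Finally" (rationally standard type) — the `C^rlf` conjunct of the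
# repaired slot: rational type of `C^rlf` PROVED, and the slot closed modulo the realification inputs

Mochizuki, *The geometry of Frobenioids I: the general theory*, Kyushu J. Math. **62** (2008)
293–400, §5, Proposition 5.5 (iii) p. 104 ll. 37–39 with proof p. 105 ll. 20–27, Prop. 5.3 p. 103
(`C^rlf` = the model Frobenioid of `(Φ^rlf, ℝ · Φ^birat)`), Thm. 5.2 (ii)/(iii) pp. 100–101, Def. 4.5
(ii)/(iii) p. 86, Def. 2.4 (i)(c)(d) pp. 47–48 (`M → M^pf → M^rlf`, `Supp`, `Prime(M^rlf) ≅ Prime(M^pf) ≅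
Prime(M)`). [cite: MochizukiFrdI2008, Prop. 5.5 (iii) p.104]

PROOF-ONLY companion (cell abc-iut, sub-DAG S7 row `FrdI:Prop5.5(iii)/P55-L07`, GAP P55iii-F1, seat
abc-iut-w5-d250) of the repaired slot `FrdI.Prop55Sub.Prop55iii_untr_rlf_ratStd'`
(`Prop55SubRatStdSlot.lean`): with BOTH support predicates THE canonical `PrimarySupp`,
* `IsPerfFactorial.Rlf.primarySupp_iff` — on `M^rlf`, `PrimarySupp α P` iff the prime of `M^pf`
  corresponding to `P` (seat abc-iut-L1-d2's `Rlf.primeSupp`) lies in the support of `α`;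
* `IsPerfFactorial.primarySupp_toRealification_iff` — hence along `M → M^rlf` the support is unchanged:
  `PrimarySupp (ι a) P ↔ PrimarySupp a 𝔭(P)` (`𝔭(P) ∈ Prime(M)` the corresponding prime; seat
  abc-iut-L1-d2's `mem_supp_factorMap_of_iff'`);
* `PreFrobenioidData.isStrictlyRational_congr_supp`, `isRational_congr_supp`,
  `isOfRationallyStandardType_congr_supp` — Def. 4.5 (ii)/(iii) see the support predicate only through
  its extension (consumers whose `Supp` obeys the support axiom rewrite to `PrimarySupp`);
* **`PreFrobenioid.isRational_rlf_of`** — Def. 4.5 (ii) for `C^rlf` from Def. 4.5 (ii) for `C`: given an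
  object `M` of `C^rlf` over `X`, take `A ∈ Ob(C)` over `X` (Def. 1.3 (i)(a)), a strictly rational
  pull-back source `A′ → A` of `C` over `X′ → X`, and the pull-back `W → M` of `C^rlf` over `X′ → X`
  (a model-Frobenioid morphism `(1, X′ → X, 0, 0)`, a pull-back morphism by seat abc-iut-L1-t2's
  `ModelFrobenioid.isPullbackMorphism_of`); `W` is strictly rational by abc-iut-L6-t10's criterion
  `ModelFrobenioid.isStrictlyRational_biratData_iff`: the witnesses `a, b ∈ Φ(X′)` with `a − b ∈ Φ^birat(X′)`
  map to `ι a, ι b ∈ Φ^rlf(X′)` with `ι a − ι b ∈ ℝ · Φ^birat(X′)` (the rational function monoid of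
  `C^rlf`) and the same supports;
* **`FrdI.Prop55Sub.prop55iii_untr_rlf_ratStd'_of`** — the repaired slot CLOSED MODULO the realification
  inputs that the tree does not carry as theorems, each a hypothesis BY NAME: (H) the Thm. 5.2 standing
  hypotheses for THE realified data and (N) "`Φ` non-dilating ⇒ `Φ^rlf` non-dilating" (both exactly as in
  seat abc-iut-w4-d084's `prop55iii_untr_rlf_standard_of`), and (K) "`((C^rlf)^un-tr)^birat` admits a
  Frobenius-compact object" (print p. 105 ll. 20–22: "`(C^un-tr)^birat` admits a Frobenius-compact object,
  so does `(C^rlf)^birat`", read for Def. 4.5 (iii)(b) of `C^rlf`; the remaining open sub-row of P55-L07).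
  The `C^un-tr` conjunct is unconditional (`prop55iii_untr_ratStd_of`); for `C^rlf`: birationally
  Frobenius-normalized by seat abc-iut-L1-d2's `rlf_isOfBiratFrobeniusNormalizedType`, standard by
  abc-iut-w4-d084's `isOfStandardType_rlf_of`, rational by `isRational_rlf_of`, (b) by (K).
No statement of the paper is strengthened; nothing here bears on [IUTchIII] Cor. 3.12.
-/

noncomputable section

namespace Literature.AlgebraicGeometry.Frobenioids

open CategoryTheory Opposite

universe w v v' u u'

/-! ### The canonical support predicate on `M^rlf` and along `M → M^rlf` -/

namespace IsPerfFactorial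

variable {M : Type w} [CommMonoid M] (h : IsPerfFactorial M)

/-- **On `M^rlf`, `PrimarySupp α P` iff `𝔮(P) ∈ Supp(α)`**, `𝔮(P) ∈ Prime(M^pf)` the prime corresponding
to `P ∈ Prime(M^rlf)` (a primary `α₀ ∈ P` with `α₀ ≼ α` is supported exactly at `𝔮(P)`, and supports grow
along `≼`; conversely the generator of `M^rlf_{𝔮(P)}` is such an `α₀`).
[cite: MochizukiFrdI2008, Def. 2.4 (i) p.48] -/
theorem Rlf.primarySupp_iff (α : h.Rlf) (P : Primes h.Rlf) :
    PrimarySupp α P ↔ Rlf.primeSupp h P ∈ supp (α : RlfFactor M) := by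
  constructor
  · rintro ⟨α₀, h₀, hcls, hle⟩
    have hs := Rlf.primeSupp_mk h α₀ h₀
    rw [hcls] at hs
    exact supp_subset_of_precsim h hle (by rw [hs]; rfl)
  · intro hq
    refine ⟨Rlf.gen h (Rlf.primeSupp h P), Rlf.isPrimary_gen h _, Rlf.primeOf_primeSupp h P, ?_⟩
    exact Rlf.precsim_of_supp h _ _ _ (Rlf.supp_gen h _).le hq

/-- **The support is unchanged along `M → M^pf → M^rlf`**: for `a ∈ M` and `P ∈ Prime(M^rlf)`,
`PrimarySupp (ι a) P ↔ PrimarySupp a 𝔭(P)`, where `𝔭(P) ∈ Prime(M)` corresponds to `P` under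
`Prime(M^rlf) ≅ Prime(M^pf) ≅ Prime(M)`. [cite: MochizukiFrdI2008, Def. 2.4 (i) p.47] -/
theorem primarySupp_toRealification_iff (a : M) (P : Primes h.Rlf) :
    PrimarySupp (h.toRealification (Perfection.of M a)) P ↔
      PrimarySupp a ((Primes.perfectionEquiv h.isDivisorial.isSharp).symm (Rlf.primeSupp h P)) := by
  rw [Rlf.primarySupp_iff]
  have e := h.mem_supp_factorMap_of_iff' a
    ((Primes.perfectionEquiv h.isDivisorial.isSharp).symm (Rlf.primeSupp h P))
  rw [Equiv.apply_symm_apply] at e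
  exact e

end IsPerfFactorial

/-! ### Def. 4.5 (ii)/(iii) only see the extension of the support predicate -/

namespace PreFrobenioidData

variable {C : Type u} [Category.{v} C] {D : Type u'} [Category.{v'} D] {S : PreFrobenioidData.{w} C D}
  (B : S.BiratData)
  {Supp Supp' : ∀ {X : D}, S.Mon X → Primes (S.Mon X) → Prop}

/-- Strict rationality (Def. 4.5 (ii)) is unchanged under an extensionally equal support predicate.
[cite: MochizukiFrdI2008, Def. 4.5 (ii) p.86] -/
theorem isStrictlyRational_congr_supp (h : ∀ (X : D) (a : S.Mon X) (𝔭 : Primes (S.Mon X)), Supp a 𝔭 ↔ Supp' a 𝔭)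
    (A : C) : IsStrictlyRational B Supp A ↔ IsStrictlyRational B Supp' A := by
  refine forall_congr' fun 𝔭 => exists_congr fun a => exists_congr fun b => ?_
  exact and_congr Iff.rfl (and_congr (h _ a 𝔭) (not_congr (h _ b 𝔭)))

/-- Rationality (Def. 4.5 (ii)) is unchanged under an extensionally equal support predicate.
[cite: MochizukiFrdI2008, Def. 4.5 (ii) p.86] -/
theorem isRational_congr_supp (h : ∀ (X : D) (a : S.Mon X) (𝔭 : Primes (S.Mon X)), Supp a 𝔭 ↔ Supp' a 𝔭)
    (A : C) : IsRational B Supp A ↔ IsRational B Supp' A := by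
  refine exists_congr fun A' => exists_congr fun φ => and_congr Iff.rfl ?_
  exact isStrictlyRational_congr_supp B h A'

/-- Rationally standard type (Def. 4.5 (iii)) is unchanged under an extensionally equal support predicate
(the other three parameters fixed). [cite: MochizukiFrdI2008, Def. 4.5 (iii) p.86] -/
theorem isOfRationallyStandardType_congr_supp (SU : PreFrobenioidData.{w} S.Untr D) (BU : SU.BiratData)
    (h : ∀ (X : D) (a : S.Mon X) (𝔭 : Primes (S.Mon X)), Supp a 𝔭 ↔ Supp' a 𝔭) :
    S.IsOfRationallyStandardType ⟨B, Supp, SU, BU⟩ ↔ S.IsOfRationallyStandardType ⟨B, Supp', SU, BU⟩ := by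
  constructor
  · rintro ⟨h₁, h₂, h₃, h₄⟩
    exact ⟨h₁, fun A => (isRational_congr_supp B h A).mp (h₂ A), h₃, h₄⟩
  · rintro ⟨h₁, h₂, h₃, h₄⟩
    exact ⟨h₁, fun A => (isRational_congr_supp B h A).mpr (h₂ A), h₃, h₄⟩

end PreFrobenioidData

/-! ### Def. 4.5 (ii) for `C^rlf` -/

namespace PreFrobenioid

variable {D : Type u} [Category.{v} D] {Φ : Dᵒᵖ ⥤ CommMonCat.{w}}
  {C : Type u'} [Category.{v'} C] {F : C ⥤ ElemFrobenioid Φ}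

open PreFrobenioidData (ofFunctor)
open Literature.AnabelianGeometry.EtaleTheta (rlfFunctor)

/-- **`C^rlf` is of rational type when `C` is** (Def. 4.5 (ii), THE support predicates): every object `M`
of `C^rlf` (the model Frobenioid of `(Φ^rlf, ℝ · Φ^birat)`) receives the pull-back morphism
`(1, X′ → X, 0, 0)` from the object `W` over the base `X′` of a strictly rational pull-back source
`A′ → A` of an object `A ∈ Ob(C)` over `X ≅ Base(M)` (Def. 1.3 (i)(a)); `W` is strictly rational: the
rational functions `a − b ∈ Φ^birat(X′)` witnessing the strict rationality of `A′` give
`ι a − ι b ∈ ℝ · Φ^birat(X′)`, and `Supp` is unchanged along `ι : Φ → Φ^rlf`.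
[cite: MochizukiFrdI2008, Prop. 5.5 (iii) p.104] -/
theorem isRational_rlf_of (hF : IsFrobenioid F) (hΦ : IsPerfFactorialOn Φ)
    (hR : IsFrobenioid (rlfToElem F hΦ)) {hsq : HasBiratSquares F}
    {hsqR : HasBiratSquares (rlfToElem F hΦ)}
    (hrat : ∀ A : C, PreFrobenioidData.IsRational (biratData hF hsq) (S := ofFunctor Φ F)
      (fun a 𝔭 => PrimarySupp a 𝔭) A)
    (M : rlf F hΦ) :
    PreFrobenioidData.IsRational (biratData hR hsqR) (S := ofFunctor _ (rlfToElem F hΦ))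
      (fun a 𝔭 => PrimarySupp a 𝔭) M := by
  -- notation
  have hΦ' := IsPerfFactorialOn.op hΦ
  let R := RealificationData.canonical Φ hΦ'
  let Ψ := biratSubfunctor F
  have hBg : Objectwise (fun M _ => IsGroupLike M) (R.realSpan Ψ).toMonoid :=
    R.realSpan_toMonoid_isGroupLike Ψ
  have hΦd : Objectwise (fun M _ => IsDivisorial M) R.rlf := RealificationData.canonical_rlf_isDivisorial hΦ'
  -- an object `A` of `C` over `Base(M)`, a strictly rational pull-back source `A' → A`
  obtain ⟨A, -, ⟨e⟩⟩ := hF.i_a M.base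
  obtain ⟨A', φ, -, hsr⟩ := hrat A
  let X' : D := baseObj F A'
  let f : X' ⟶ M.base := Base F φ ≫ e.hom
  -- the pull-back `W → M` of `C^rlf` over `f`
  let W : rlf F hΦ := ⟨X', pullGp R.rlf f M.cls⟩
  let ψ : W ⟶ M := ModelFrobenioid.mkHom W M 1 f 1 1 (by
    rw [PNat.one_coe, pow_one, map_one, mul_one, map_one, mul_one])
  have hψ : IsPullbackMorphism (rlfToElem F hΦ) ψ :=
    ModelFrobenioid.isPullbackMorphism_of hΦd hBg rfl rfl
  refine ⟨W, ψ, (PreFrobenioidData.ofFunctor_isPullbackMorphism _ ψ).mpr hψ, ?_⟩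
  -- `W` is strictly rational
  refine (ModelFrobenioid.isStrictlyRational_biratData_iff hBg hΦd hR hsqR _ W).mpr fun P => ?_
  let hM : IsPerfFactorial (Φ.obj (op X')) := hΦ' (op X')
  obtain ⟨a, b, hab, ha, hb⟩ :=
    hsr ((Primes.perfectionEquiv hM.isDivisorial.isSharp).symm (IsPerfFactorial.Rlf.primeSupp hM P))
  change ↥(Φ.obj (op X')) at a b
  change Algebra.GrothendieckGroup.of a / Algebra.GrothendieckGroup.of b ∈ biratSubgroup F X' at hab
  change PrimarySupp a _ at ha
  change ¬ PrimarySupp b _ at hb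
  let ι : ↥(Φ.obj (op X')) →* ↥(R.rlf.obj (op X')) := (R.toRlf.app (op X')).hom
  have hmem : R.toRlfGp X' (Algebra.GrothendieckGroup.of a / Algebra.GrothendieckGroup.of b) ∈
      (R.realSpan Ψ).carrier X' :=
    Subgroup.subset_closure ⟨1, _, hab, (R.rsmul_one X' _).symm⟩
  have hdiv : R.toRlfGp X' (Algebra.GrothendieckGroup.of a / Algebra.GrothendieckGroup.of b) =
      Algebra.GrothendieckGroup.of (ι a) / Algebra.GrothendieckGroup.of (ι b) := by
    rw [map_div, RealificationData.toRlfGp, MonGp.map_of, MonGp.map_of]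
  have hι : ∀ x : ↥(Φ.obj (op X')), ι x = hM.toRealification (Perfection.of _ x) := fun x => rfl
  refine ⟨ι a, ι b, ⟨⟨_, hmem⟩, hdiv.symm⟩, ?_, ?_⟩
  · rw [hι]
    exact (hM.primarySupp_toRealification_iff a P).mpr ha
  · rw [hι]
    exact fun hb' => hb ((hM.primarySupp_toRealification_iff b P).mp hb')

end PreFrobenioid

/-! ### The repaired slot, closed modulo the realification inputs -/

namespace FrdI.Prop55Sub

open PreFrobenioid PreFrobenioidData
open Literature.AnabelianGeometry.EtaleTheta (rlfFunctor)

variable {D : Type u} [Category.{v} D] {Φ : Dᵒᵖ ⥤ CommMonCat.{w}}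
  {C : Type u'} [Category.{v'} C] (F : C ⥤ ElemFrobenioid Φ)

/-- **Proposition 5.5 (iii), "Finally", rationally standard type — the repaired slot
`Prop55iii_untr_rlf_ratStd'` CLOSED MODULO the realification inputs (H), (N), (K)** (hypotheses BY NAME,
not facts of the tree): (H) the standing hypotheses of Thm. 5.2 for THE realified data
`(Φ^rlf, ℝ · Φ^birat)`, (N) "`Φ` non-dilating ⇒ `Φ^rlf` non-dilating", (K) "`((C^rlf)^un-tr)^birat` admits a
Frobenius-compact object". The `C^un-tr` conjunct is unconditional (`prop55iii_untr_ratStd_of`); for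
`C^rlf`: birationally Frobenius-normalized (abc-iut-L1-d2), standard (abc-iut-w4-d084, from (H), (N)),
rational (`isRational_rlf_of`), Def. 4.5 (iii)(b) = (K). [cite: MochizukiFrdI2008, Prop. 5.5 (iii) p.104] -/
theorem prop55iii_untr_rlf_ratStd'_of (hF : IsFrobenioid F) (hΦ : IsPerfFactorialOn Φ)
    (hH : ModelFrobenioid.Hypotheses (rlfFunctor Φ (IsPerfFactorialOn.op hΦ))
      ((RealificationData.canonical Φ (IsPerfFactorialOn.op hΦ)).realSpan (biratSubfunctor F)).toMonoid)
    (hN : (PreFrobenioidData.ofFunctor Φ F).IsNonDilatingOn →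
      IsNonDilatingOn (rlfFunctor Φ (IsPerfFactorialOn.op hΦ)))
    (hK : ∀ hR : IsFrobenioid (rlfToElem F hΦ),
      ∃ Y : Birat (untrFunctor hR) (isFrobenioid_untr hR) (hasBiratSquares_untr hR),
        (PreFrobenioidData.ofFunctor (zeroMonoid D)
          (Birat.toElemZero (isFrobenioid_untr hR) (hasBiratSquares_untr hR))).IsFrobeniusCompact Y) :
    Prop55iii_untr_rlf_ratStd' F hF hΦ := by
  intro hiso hnorm hng h
  refine ⟨prop55iii_untr_ratStd_of F hF _ hng h, fun hR => ?_⟩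
  exact
    { biratFrobNormalized := rlf_isOfBiratFrobeniusNormalizedType F hΦ hR
      rational := isRational_rlf_of hF hΦ hR h.rational
      standard := (prop55iii_untr_rlf_standard_of F hF hΦ hH hN hiso hnorm hng h.standard).2
      frobCompact := hK hR }

end FrdI.Prop55Sub

end Literature.AlgebraicGeometry.Frobenioids

end
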